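import Summits.ValiantsHypothesis.ValiantsHypothesis.Theorems.DivisionGapZeroOneTransferStubFormulaGridProjectionAux7
import Summits.ValiantsHypothesis.ValiantsHypothesis.Theorems.DivisionGapZeroOneTransferStubFormulaGridProjectionAux3

/-!
# Crux `DivisionGap.ZeroOneTransfer` (stmt-ValiantsHypothesis-5066), line `planar-dimer-sign-elimination` —
stub `stub_formulaGridProjection`, support file 8

support file 8: the parallel layout, part 2 — the core two-state gadget

`par_core`: the upper gadget `F`, the wired lower gadget (file 7) and the six-vertex frame form a
two-state gadget for `x * gF + y * (1 * gG * 1)` with ports `(r, c)` and `(r, c+m+1)` — the abstract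
parallel composition `twoState_par` (file 3) with its twenty side conditions read off the
frame-and-wire weight `parX` (file 6) — and the total weight `parW` consists of labels and is
supported on adjacent cells of the big `(hF+hG+2) × (m+2)` rectangle.

Registered sub-goal proved here: `stub_formulaGridProjection_parallelLabels` (all dart weights of
the parallel layout are labels). [folklore]
-/

set_option linter.dupNamespace false

namespace Summit.ValiantsHypothesis.ValiantsHypothesis.Theorems.DivisionGapZeroOneTransfer

namespace FormulaGridProjection

open Finset MvPolynomial

/-- `TwoState⟦D, W, p, q, g⟧` (a LOCAL NOTATION, deliberately not a definition): a TWO-STATE GADGET on the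
vertex set `D` with ports `p ≠ q` computing `g` — the whole of `D` has matching sum `g` ("active": both
ports matched inside), `D ∖ {p, q}` has matching sum `1` ("inactive"), and `|D|` is even (so the two
mixed states have matching sum `0` by parity).  The two-attachment case of a gadget signature
(Valiant 1979 §2; DKLM 2010 §4.4). -/
local notation3 "TwoState⟦" D ", " W ", " p ", " q ", " g "⟧" =>
  p ∈ D ∧ q ∈ D ∧ p ≠ q ∧ Even (Finset.card D) ∧ msum D W = g ∧
    msum (Finset.erase (Finset.erase D p) q) W = 1


/-- `IsLab⟦x⟧` (local notation): `x` is literally a variable `X j` or a constant `C c` — the entries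
allowed in a Valiant projection (`IsProjection`). -/
local notation3 "IsLab⟦" x "⟧" => (∃ j, x = MvPolynomial.X j) ∨ ∃ c, x = MvPolynomial.C c

/-- `Adj⟦a, b⟧` (local notation): adjacency of the square grid on `ℕ × ℕ`, verbatim the four disjuncts
of the route's grid-dimer polynomial. -/
local notation3 "Adj⟦" a ", " b "⟧" =>
  (Prod.fst a + 1 = Prod.fst b ∧ Prod.snd a = Prod.snd b) ∨
    (Prod.fst b + 1 = Prod.fst a ∧ Prod.snd a = Prod.snd b) ∨
    (Prod.fst a = Prod.fst b ∧ Prod.snd a + 1 = Prod.snd b) ∨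
    (Prod.fst a = Prod.fst b ∧ Prod.snd b + 1 = Prod.snd a)

/-- `box⟦r, c, h, w⟧` (local notation): the `h × w` rectangle of cells with top-left cell `(r, c)`
(rows `r ≤ i < r + h`, columns `c ≤ j < c + w`). -/
local notation3 "box⟦" r ", " c ", " h ", " w "⟧" =>
  (Finset.Ico r (r + h) ×ˢ Finset.Ico c (c + w) : Finset (ℕ × ℕ))

/-- `Gad⟦W, r, c, h, w, g⟧` (local notation): `W` is a GRID GADGET for `g` on the rectangle
`box⟦r, c, h, w⟧` — every dart weight is a label, non-zero weights only on darts between adjacent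
cells of the rectangle, and the rectangle is a two-state gadget computing `g` with ports its
top-left and top-right cells. -/
local notation3 "Gad⟦" W ", " r ", " c ", " h ", " w ", " g "⟧" =>
  (∀ a b, IsLab⟦W a b⟧) ∧ (∀ a b, W a b ≠ 0 → a ∈ box⟦r, c, h, w⟧ ∧ b ∈ box⟦r, c, h, w⟧ ∧ Adj⟦a, b⟧) ∧
    TwoState⟦box⟦r, c, h, w⟧, W, (r, c), (r, c + w - 1), g⟧

section ParCore

variable {R : Type*} [CommSemiring R] {ι : Type*}

set_option maxHeartbeats 1600000 in
-- sixteen frame darts and eight neighbourhoods, each a short `omega` check against `parX`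
/-- The core of the parallel layout is a two-state gadget for `x * gF + y * (1 * gG * 1)`
(`twoState_par` of file 3 applied to `F` and the wired `G`), all weights of `parW` are labels, and
its non-zero darts join adjacent cells of the big rectangle. [folklore] -/
theorem par_core {WF WG : ℕ × ℕ → ℕ × ℕ → MvPolynomial ι R} {r c hF hG m : ℕ}
    {gF gG x y : MvPolynomial ι R} (hGF : Gad⟦WF, r + 1, c + 1, hF, m, gF⟧)
    (hGG : Gad⟦WG, r + 1 + hF, c + 1, hG, m, gG⟧) (hx : IsLab⟦x⟧) (hy : IsLab⟦y⟧)
    (ehF : Even hF) (ehG : Even hG) (em : Even m) (h2F : 2 ≤ hF) (h2G : 2 ≤ hG) (h2m : 2 ≤ m) :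
    TwoState⟦box⟦r + 1, c + 1, hF, m⟧ ∪
      ((((box⟦r + 2, c, hF, 1⟧ ∪ box⟦r + 1 + hF, c + 1, hG, m⟧) ∪ box⟦r + 2, c + m + 1, hF, 1⟧)) ∪
        {(r, c), (r, c + m + 1), (r, c + 1), (r + 1, c), (r, c + m), (r + 1, c + m + 1)}),
      parW WF WG r c hF m x y, (r, c), (r, c + m + 1), x * gF + y * (1 * gG * 1)⟧ ∧
    (∀ a b, IsLab⟦parW WF WG r c hF m x y a b⟧) ∧
    (∀ a b, parW WF WG r c hF m x y a b ≠ 0 → a ∈ box⟦r, c, hF + hG + 2, m + 2⟧ ∧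
      b ∈ box⟦r, c, hF + hG + 2, m + 2⟧ ∧ Adj⟦a, b⟧) := by
  obtain ⟨hTF', hGw⟩ := par_wired hGF hGG ehF ehG em h2F h2m
  obtain ⟨hlabF, hsuppF, hTF⟩ := hGF
  obtain ⟨hlabG, hsuppG, hTG⟩ := hGG
  obtain ⟨kF, hkF⟩ := ehF
  obtain ⟨kG, hkG⟩ := ehG
  obtain ⟨km, hkm⟩ := em
  obtain ⟨hXS, hXF, hXG, zF, zG, zX, X1, X2, X3, X4, X5, X6, X7, X8, X9, X10, hWside⟩ :=
    par_prelims (x := x) (y := y) (hG := hG) hsuppF hsuppG h2F h2m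
  set X := parX r c hF m x y with hXd
  set W := parW WF WG r c hF m x y with hWd
  have hX : ∀ u v, X u v =
      if u.1 = r ∧ u.2 = c ∧ v.1 = r ∧ v.2 = c + 1 then x else
      if u.1 = r ∧ u.2 = c ∧ v.1 = r + 1 ∧ v.2 = c then y else
      if ((u.1 = r ∧ u.2 = c + 1 ∧ v.1 = r ∧ v.2 = c) ∨
        (u.1 = r + 1 ∧ u.2 = c ∧ v.1 = r ∧ v.2 = c) ∨
        (u.1 = r ∧ v.1 = r ∧ ((u.2 = c + m + 1 ∧ v.2 = c + m) ∨ (u.2 = c + m ∧ v.2 = c + m + 1))) ∨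
        (u.2 = c + m + 1 ∧ v.2 = c + m + 1 ∧ ((u.1 = r ∧ v.1 = r + 1) ∨ (u.1 = r + 1 ∧ v.1 = r))) ∨
        (u.2 = c + 1 ∧ v.2 = c + 1 ∧ ((u.1 = r ∧ v.1 = r + 1) ∨ (u.1 = r + 1 ∧ v.1 = r))) ∨
        (u.2 = c + m ∧ v.2 = c + m ∧ ((u.1 = r ∧ v.1 = r + 1) ∨ (u.1 = r + 1 ∧ v.1 = r))) ∨
        (u.2 = c ∧ v.2 = c ∧ r + 1 ≤ u.1 ∧ r + 1 ≤ v.1 ∧ u.1 ≤ r + 1 + hF ∧ v.1 ≤ r + 1 + hF ∧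
          (u.1 + 1 = v.1 ∨ v.1 + 1 = u.1)) ∨
        (u.2 = c + m + 1 ∧ v.2 = c + m + 1 ∧ r + 1 ≤ u.1 ∧ r + 1 ≤ v.1 ∧ u.1 ≤ r + 1 + hF ∧
          v.1 ≤ r + 1 + hF ∧ (u.1 + 1 = v.1 ∨ v.1 + 1 = u.1)) ∨
        (u.1 = r + 1 + hF ∧ v.1 = r + 1 + hF ∧
          ((u.2 = c ∧ v.2 = c + 1) ∨ (u.2 = c + 1 ∧ v.2 = c))) ∨
        (u.1 = r + 1 + hF ∧ v.1 = r + 1 + hF ∧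
          ((u.2 = c + m + 1 ∧ v.2 = c + m) ∨ (u.2 = c + m ∧ v.2 = c + m + 1)))) then 1 else 0 := fun u v => by rw [hXd]; exact parX_apply r c hF m x y u v
  have hW : ∀ u v, W u v = WF u v + WG u v + X u v := fun u v => rfl
  -- the parallel composition of `F` and the wired `G` through the frame
  have hpar : TwoState⟦box⟦r + 1, c + 1, hF, m⟧ ∪
      ((((box⟦r + 2, c, hF, 1⟧ ∪ box⟦r + 1 + hF, c + 1, hG, m⟧) ∪ box⟦r + 2, c + m + 1, hF, 1⟧)) ∪
        {(r, c), (r, c + m + 1), (r, c + 1), (r + 1, c), (r, c + m), (r + 1, c + m + 1)}),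
      W, (r, c), (r, c + m + 1), x * gF + y * (1 * gG * 1)⟧ := by
    refine twoState_par hTF' hGw ?_ ?_ ?_ ?_ ?_ ?_ ?_ ?_ ?_ ?_ ?_ ?_ ?_ ?_ ?_ ?_ ?_ ?_ ?_ ?_
    · rw [Finset.disjoint_left]
      intro a ha hb
      rw [Finset.mem_union, Finset.mem_union, mem_box, mem_box, mem_box] at hb
      rw [mem_box] at ha
      omega
    · rw [Finset.disjoint_left]
      intro a ha hb
      rw [mem_box] at ha
      simp only [Finset.mem_insert, Finset.mem_singleton, Prod.ext_iff] at hb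
      omega
    · rw [Finset.disjoint_left]
      intro a ha hb
      rw [Finset.mem_union, Finset.mem_union, mem_box, mem_box, mem_box] at ha
      simp only [Finset.mem_insert, Finset.mem_singleton, Prod.ext_iff] at hb
      omega
    · simp only [List.nodup_cons, List.mem_cons, List.not_mem_nil, Prod.ext_iff, or_false, not_or,
        List.nodup_nil, and_true, true_and, not_false_eq_true]
      omega
    · intro u hu v hv hne
      rw [mem_box] at hu hv
      rw [hW, zF u v (Or.inr (by rw [mem_box]; omega)), zG u v (Or.inl (by rw [mem_box]; omega)),
        zero_add, zero_add] at hne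
      have := hXS u v hne
      simp only [Prod.ext_iff]
      omega
    · intro u hu v hv hne
      rw [Finset.mem_union, Finset.mem_union, mem_box, mem_box, mem_box] at hu hv
      rw [hW, zF u v (Or.inl (by rw [mem_box]; omega)), zG u v (Or.inr (by rw [mem_box]; omega)),
        zero_add, zero_add] at hne
      have := hXS u v hne
      simp only [Prod.ext_iff]
      omega
    · intro v hne
      rw [hWside _ _ (Or.inl rfl), hX] at hne
      split_ifs at hne with h1 h2 h3
      · exact Or.inl (Prod.ext (by dsimp only; omega) (by dsimp only; omega))
      · exact Or.inr (Prod.ext (by dsimp only; omega) (by dsimp only; omega))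
      · dsimp only at h3
        omega
      · exact absurd rfl hne
    · intro v hne
      rw [hWside _ _ (Or.inr rfl)] at hne
      have := hXS _ _ hne
      dsimp only at this
      simp only [Prod.ext_iff]
      omega
    · intro v hne
      have h0F : WF (r, c + 1) v = 0 := zF _ _ (Or.inl (by rw [mem_box]; dsimp only; omega))
      have h0G : WG (r, c + 1) v = 0 := zG _ _ (Or.inl (by rw [mem_box]; dsimp only; omega))
      rw [hW, h0F, h0G, zero_add, zero_add] at hne
      have := hXS _ _ hne
      dsimp only at this
      simp only [Prod.ext_iff]
      omega
    · intro v hne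
      have h0F : WF (r, c + m) v = 0 := zF _ _ (Or.inl (by rw [mem_box]; dsimp only; omega))
      have h0G : WG (r, c + m) v = 0 := zG _ _ (Or.inl (by rw [mem_box]; dsimp only; omega))
      rw [hW, h0F, h0G, zero_add, zero_add] at hne
      have := hXS _ _ hne
      dsimp only at this
      simp only [Prod.ext_iff]
      omega
    · intro v hne
      rw [hWside _ _ (Or.inl rfl)] at hne
      have := hXS _ _ hne
      dsimp only at this
      simp only [Prod.ext_iff]
      omega
    · intro v hne
      rw [hWside _ _ (Or.inr rfl)] at hne
      have := hXS _ _ hne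
      dsimp only at this
      simp only [Prod.ext_iff]
      omega
    · -- `p → pF` carries `x`, `pF → p` is unit
      have h1 : W (r, c) (r, c + 1) = x := by
        rw [hWside _ _ (Or.inl rfl), hX, if_pos (by dsimp only; omega)]
      have h0F : WF (r, c + 1) (r, c) = 0 := zF _ _ (Or.inl (by rw [mem_box]; dsimp only; omega))
      have h0G : WG (r, c + 1) (r, c) = 0 := zG _ _ (Or.inl (by rw [mem_box]; dsimp only; omega))
      have h2 : W (r, c + 1) (r, c) = 1 := by
        rw [hW, h0F, h0G, zero_add, zero_add, X1 _ _ (by dsimp only; omega)]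
      rw [h1, h2, mul_one]
    · have h1 : W (r, c) (r + 1, c) = y := by
        rw [hWside _ _ (Or.inl rfl), hX, if_neg (by dsimp only; omega), if_pos (by dsimp only; omega)]
      have h2 : W (r + 1, c) (r, c) = 1 := by
        rw [hWside _ _ (Or.inl rfl), X2 _ _ (by dsimp only; omega)]
      rw [h1, h2, mul_one]
    · have h1 : W (r, c + m + 1) (r, c + m) = 1 := by
        rw [hWside _ _ (Or.inr rfl), X3 _ _ (by dsimp only; omega)]
      have h0F : WF (r, c + m) (r, c + m + 1) = 0 :=
        zF _ _ (Or.inl (by rw [mem_box]; dsimp only; omega))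
      have h0G : WG (r, c + m) (r, c + m + 1) = 0 :=
        zG _ _ (Or.inl (by rw [mem_box]; dsimp only; omega))
      have h2 : W (r, c + m) (r, c + m + 1) = 1 := by
        rw [hW, h0F, h0G, zero_add, zero_add, X3 _ _ (by dsimp only; omega)]
      rw [h1, h2, mul_one]
    · have h1 : W (r, c + m + 1) (r + 1, c + m + 1) = 1 := by
        rw [hWside _ _ (Or.inr rfl), X4 _ _ (by dsimp only; omega)]
      have h2 : W (r + 1, c + m + 1) (r, c + m + 1) = 1 := by
        rw [hWside _ _ (Or.inr rfl), X4 _ _ (by dsimp only; omega)]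
      rw [h1, h2, mul_one]
    · have h0F : WF (r + 1, c + 1) (r, c + 1) = 0 :=
        zF _ _ (Or.inr (by rw [mem_box]; dsimp only; omega))
      have h0G : WG (r + 1, c + 1) (r, c + 1) = 0 :=
        zG _ _ (Or.inl (by rw [mem_box]; dsimp only; omega))
      have h1 : W (r + 1, c + 1) (r, c + 1) = 1 := by
        rw [hW, h0F, h0G, zero_add, zero_add, X5 _ _ (by dsimp only; omega)]
      have h0F' : WF (r, c + 1) (r + 1, c + 1) = 0 :=
        zF _ _ (Or.inl (by rw [mem_box]; dsimp only; omega))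
      have h0G' : WG (r, c + 1) (r + 1, c + 1) = 0 :=
        zG _ _ (Or.inl (by rw [mem_box]; dsimp only; omega))
      have h2 : W (r, c + 1) (r + 1, c + 1) = 1 := by
        rw [hW, h0F', h0G', zero_add, zero_add, X5 _ _ (by dsimp only; omega)]
      rw [h1, h2, mul_one]
    · have h0F : WF (r + 1, c + 1 + m - 1) (r, c + m) = 0 :=
        zF _ _ (Or.inr (by rw [mem_box]; dsimp only; omega))
      have h0G : WG (r + 1, c + 1 + m - 1) (r, c + m) = 0 :=
        zG _ _ (Or.inl (by rw [mem_box]; dsimp only; omega))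
      have h1 : W (r + 1, c + 1 + m - 1) (r, c + m) = 1 := by
        rw [hW, h0F, h0G, zero_add, zero_add, X6 _ _ (by dsimp only; omega)]
      have h0F' : WF (r, c + m) (r + 1, c + 1 + m - 1) = 0 :=
        zF _ _ (Or.inl (by rw [mem_box]; dsimp only; omega))
      have h0G' : WG (r, c + m) (r + 1, c + 1 + m - 1) = 0 :=
        zG _ _ (Or.inl (by rw [mem_box]; dsimp only; omega))
      have h2 : W (r, c + m) (r + 1, c + 1 + m - 1) = 1 := by
        rw [hW, h0F', h0G', zero_add, zero_add, X6 _ _ (by dsimp only; omega)]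
      rw [h1, h2, mul_one]
    · have h1 : W (r + 2, c) (r + 1, c) = 1 := by
        rw [hWside _ _ (Or.inl rfl), X7 _ _ (by dsimp only; omega)]
      have h2 : W (r + 1, c) (r + 2, c) = 1 := by
        rw [hWside _ _ (Or.inl rfl), X7 _ _ (by dsimp only; omega)]
      rw [h1, h2, mul_one]
    · have h1 : W (r + 2, c + m + 1) (r + 1, c + m + 1) = 1 := by
        rw [hWside _ _ (Or.inr rfl), X8 _ _ (by dsimp only; omega)]
      have h2 : W (r + 1, c + m + 1) (r + 2, c + m + 1) = 1 := by
        rw [hWside _ _ (Or.inr rfl), X8 _ _ (by dsimp only; omega)]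
      rw [h1, h2, mul_one]
  -- labels and support of `W`
  have hlab : ∀ a b, IsLab⟦W a b⟧ := by
    intro a b
    rw [hW]
    refine isLab_add (isLab_add (hlabF a b) (hlabG a b) ?_)
      (by rw [hX]; exact isLab_ite hx (isLab_ite hy (isLab_ite isLab_one isLab_zero))) ?_
    · by_cases ha : a ∈ box⟦r + 1, c + 1, hF, m⟧
      · rw [mem_box] at ha
        exact Or.inr (zG a b (Or.inl (by rw [mem_box]; omega)))
      · exact Or.inl (zF a b (Or.inl ha))
    · by_cases hXz : X a b = 0
      · exact Or.inr hXz
      · left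
        rw [zF a b (hXF a b hXz), zG a b (hXG a b hXz), add_zero]
  have hsuppB : ∀ a b, W a b ≠ 0 → a ∈ box⟦r, c, hF + hG + 2, m + 2⟧ ∧
      b ∈ box⟦r, c, hF + hG + 2, m + 2⟧ ∧ Adj⟦a, b⟧ := by
    intro a b hab
    rw [hW] at hab
    by_cases h1 : WF a b = 0
    · by_cases h2 : WG a b = 0
      · rw [h1, h2, zero_add, zero_add] at hab
        have := hXS a b hab
        rw [mem_box, mem_box]
        omega
      · obtain ⟨ha, hb, hadj⟩ := hsuppG a b h2
        rw [mem_box] at ha hb ⊢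
        rw [mem_box]
        exact ⟨by omega, by omega, hadj⟩
    · obtain ⟨ha, hb, hadj⟩ := hsuppF a b h1
      rw [mem_box] at ha hb ⊢
      rw [mem_box]
      exact ⟨by omega, by omega, hadj⟩
  exact ⟨hpar, hlab, hsuppB⟩

end ParCore

end FormulaGridProjection

open Finset FormulaGridProjection in
/-- **Registered sub-goal `stub_formulaGridProjection_parallelLabels`** of `stub_formulaGridProjection`
(crux stmt-ValiantsHypothesis-5066, line `planar-dimer-sign-elimination`): every dart weight of the
parallel grid layout of two grid gadgets is a label (a variable or a constant), so the layout stays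
a Valiant projection. [folklore] -/
theorem stub_formulaGridProjection_parallelLabels : ∀ (R : Type) [CommSemiring R] (ι : Type) (WF WG : ℕ × ℕ → ℕ × ℕ → MvPolynomial ι R) (r c hF hG m : ℕ) (gF gG x y : MvPolynomial ι R), ((∀ a b, ((∃ j, WF a b = MvPolynomial.X j) ∨ ∃ c, WF a b = MvPolynomial.C c)) ∧ (∀ a b, WF a b ≠ 0 → a ∈ (Finset.Ico (r + 1) ((r + 1) + hF) ×ˢ Finset.Ico (c + 1) ((c + 1) + m)) ∧ b ∈ (Finset.Ico (r + 1) ((r + 1) + hF) ×ˢ Finset.Ico (c + 1) ((c + 1) + m)) ∧ ((a.1 + 1 = b.1 ∧ a.2 = b.2) ∨ (b.1 + 1 = a.1 ∧ a.2 = b.2) ∨ (a.1 = b.1 ∧ a.2 + 1 = b.2) ∨ (a.1 = b.1 ∧ b.2 + 1 = a.2))) ∧ (((r + 1), (c + 1)) ∈ (Finset.Ico (r + 1) ((r + 1) + hF) ×ˢ Finset.Ico (c + 1) ((c + 1) + m)) ∧ ((r + 1), (c + 1) + m - 1) ∈ (Finset.Ico (r + 1) ((r + 1) + hF) ×ˢ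 Finset.Ico (c + 1) ((c + 1) + m)) ∧ ((r + 1), (c + 1)) ≠ ((r + 1), (c + 1) + m - 1) ∧ Even (Finset.card (Finset.Ico (r + 1) ((r + 1) + hF) ×ˢ Finset.Ico (c + 1) ((c + 1) + m))) ∧ FormulaGridProjection.msum (Finset.Ico (r + 1) ((r + 1) + hF) ×ˢ Finset.Ico (c + 1) ((c + 1) + m)) WF = gF ∧ FormulaGridProjection.msum (Finset.erase (Finset.erase (Finset.Ico (r + 1) ((r + 1) + hF) ×ˢ Finset.Ico (c + 1) ((c + 1) + m)) ((r + 1), (c + 1))) ((r + 1), (c + 1) + m - 1)) WF = 1)) → ((∀ a b, ((∃ j, WG a b = MvPolynomial.X j) ∨ ∃ c, WG a b = MvPolynomial.C c)) ∧ (∀ a b, WG a b ≠ 0 → a ∈ (Finset.Ico (r + 1 + hF) ((r + 1 + hF) + hG) ×ˢ Finset.Ico (c + 1) ((c + 1) + m)) ∧ b ∈ (Finset.Ico (r + 1 + hF) ((r + 1 + hF) + hG) ×ˢ Finset.Ico (c + 1) ((c + 1) + m)) ∧ ((a.1 + 1 = b.1 ∧ a.2 = b.2) ∨ (b.1 + 1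 = a.1 ∧ a.2 = b.2) ∨ (a.1 = b.1 ∧ a.2 + 1 = b.2) ∨ (a.1 = b.1 ∧ b.2 + 1 = a.2))) ∧ (((r + 1 + hF), (c + 1)) ∈ (Finset.Ico (r + 1 + hF) ((r + 1 + hF) + hG) ×ˢ Finset.Ico (c + 1) ((c + 1) + m)) ∧ ((r + 1 + hF), (c + 1) + m - 1) ∈ (Finset.Ico (r + 1 + hF) ((r + 1 + hF) + hG) ×ˢ Finset.Ico (c + 1) ((c + 1) + m)) ∧ ((r + 1 + hF), (c + 1)) ≠ ((r + 1 + hF), (c + 1) + m - 1) ∧ Even (Finset.card (Finset.Ico (r + 1 + hF) ((r + 1 + hF) + hG) ×ˢ Finset.Ico (c + 1) ((c + 1) + m))) ∧ FormulaGridProjection.msum (Finset.Ico (r + 1 + hF) ((r + 1 + hF) + hG) ×ˢ Finset.Ico (c + 1) ((c + 1) + m)) WG = gG ∧ FormulaGridProjection.msum (Finset.erase (Finset.erase (Finset.Ico (r + 1 + hF) ((r + 1 + hF) + hG) ×ˢ Finset.Ico (c + 1) ((c + 1) + m)) ((r + 1 + hF), (c + 1))) ((r + 1 + hF), (c + 1)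 + m - 1)) WG = 1)) → ((∃ j, x = MvPolynomial.X j) ∨ ∃ c, x = MvPolynomial.C c) → ((∃ j, y = MvPolynomial.X j) ∨ ∃ c, y = MvPolynomial.C c) → Even hF → Even hG → Even m → 2 ≤ hF → 2 ≤ hG → 2 ≤ m → ∀ a b, ((∃ j, (FormulaGridProjection.parW WF WG r c hF m x y) a b = MvPolynomial.X j) ∨ ∃ cst, (FormulaGridProjection.parW WF WG r c hF m x y) a b = MvPolynomial.C cst) :=
  fun _ _ _ _ _ _ _ _ _ _ _ _ _ _ hF hG hx hy ehF ehG em h2F h2G h2m =>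
    (par_core hF hG hx hy ehF ehG em h2F h2G h2m).2.1

end Summit.ValiantsHypothesis.ValiantsHypothesis.Theorems.DivisionGapZeroOneTransfer
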